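import Literature.AnabelianGeometry.EtaleTheta.SettingModelChiShearInner
import HarnessLib

/-!
# Models of the [EtTh] §1 root, R78 STAGE 2: JOINT continuity of a family of endomorphisms of `F̂₂` from the
# continuity of its two generator orbits; the affine action `Inn(b^m) ∘ shear k ∘ θ_α` (proof-only)

Mochizuki, *The étale theta function …*, Publ. RIMS **45** (2009) [EtTh], §1, PRIMS PDF p. 12
[cite: MochizukiEtTh2009, §1 p.12] ("`Δ_X` … a profinite free group on 2 generators"; the semi-direct product
structure of "`Π^tp_X`" over "`G_K`") and Prop. 1.5 (iii) p. 23 (the affine `Z`-action).  abc-iut cell, layer L2,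
R78 cluster STAGE 2 («Tate shear», integrator abc-iut-L6-d6, R78-MAP #5), seat abc-iut-w5-d249 (gen 5): the
joint-continuity INPUT of hand F4q (`SettingModelTateSemidirect.lean`: `Γ ⋊ G_{ℚ_p}` along
`σ ↦ affTwist₃ ⟨((κ_p σ)^i, (κ_p σ)^j), χ σ⟩` is a topological group).  PROOF-ONLY (0 definitions), over
abc-iut-w5-d024's F2 (`eta`, `bPow`, `twist`, `ext_of_eta`), abc-iut-L2-t6's F2b/F2c (`shear`, `innB`, `affTwist₃`,
`affTwist₃Gfp`, `diagAut`) and abc-iut-L2-t1's root chain (`F₂hatT`, `Gfp`) — consumed BY NAME, nothing restated.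

WHAT IS PROVED (pure profinite group theory, any topological space `G` of parameters):
* **`continuous_action_of_continuous_apply_eta`** — a family `Φ : G → End(F̂₂)` of continuous endomorphisms of
  the free profinite group `F̂₂ = ⟨a, b⟩^` is JOINTLY continuous in `(σ, x)` as soon as the two orbit maps
  `σ ↦ Φ σ (η a)`, `σ ↦ Φ σ (η b)` are continuous: each finite component `F̂₂ → F₂/H` of `Φ σ` is determined by its
  values on `η a`, `η b` (`ext_of_eta`), hence locally constant in `σ`, and it is continuous in `x`.  (This replaces
  the level-wise `val_twist_eq` computation of F2b's `continuous_twist_of_isLocallyConstant` by a uniform argument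
  and needs no formula for the action on any quotient — cf. abc-iut-L6-d6's R78-MAP #5 warning that the shear does
  NOT descend to `Heis(ℤ/N)`.)
* `continuous_actionGfp_of_continuous_action` — transport to `Γ = F̂₂ ×_Ẑ ℤ` for families acting by `Ψ σ × id`.
* `affTwist₃_eta_of_zero` / `affTwist₃_eta_of_one` — the generator orbits of the three-parameter affine action:
  `η a ↦ b^m · (η a · b^k) · b^{−m}`, `η b ↦ b^{α(1)}`;
* **`continuous_affTwist₃_of_continuous`** / **`continuous_affTwist₃Gfp_of_continuous`** — for ANY
  `ρ : G → (Ẑ × Ẑ) ⋊_{diag} Ẑ^×` whose three coordinates `m = (ρ σ).left.1`, `k = (ρ σ).left.2`, `(ρ σ).right (1)`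
  are continuous `G → Ẑ`, the action `(σ, x) ↦ affTwist₃ (ρ σ) x` on `F̂₂` (resp. `affTwist₃Gfp` on `Γ`) is jointly
  continuous.
SEMI-SYNTHETIC MODEL INPUT, CONSISTENCY EVIDENCE ONLY; nothing of [EtTh] is asserted; no side is taken on
[IUTchIII] Cor. 3.12.
-/

noncomputable section

namespace Literature.AnabelianGeometry.EtaleTheta.SettingModel

open Literature.AnabelianGeometry.SemiGraphs _root_.Topology _root_.Function
open CategoryTheory ProfiniteGrp ProfiniteGrp.ProfiniteCompletion

/-! ### Joint continuity of a family of endomorphisms of `F̂₂` from its two generator orbits -/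

/-- **Joint continuity from the two topological generators.**  Let `Φ : G → End(F̂₂)` be a family of
continuous endomorphisms of the free profinite group `F̂₂ = ⟨a, b⟩^` indexed by a topological space `G`, such that
the orbit maps of the two generators `σ ↦ Φ σ (η a)` and `σ ↦ Φ σ (η b)` are continuous.  Then
`(σ, x) ↦ Φ σ x` is jointly continuous: for each normal `H ≤ F₂` of finite index the component
`F̂₂ → F₂/H` of `Φ σ` is determined by its (locally constant) values on `η a`, `η b` (`ext_of_eta`), hence locally
constant in `σ`, and continuous in `x`. [cite: MochizukiEtTh2009, §1 p.12] -/
theorem continuous_action_of_continuous_apply_eta {G : Type*} [TopologicalSpace G]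
    (Φ : G → F₂hatT →* F₂hatT) (hc : ∀ σ, Continuous (Φ σ))
    (h0 : Continuous fun σ => Φ σ (eta (FreeGroup.of 0)))
    (h1 : Continuous fun σ => Φ σ (eta (FreeGroup.of 1))) :
    Continuous fun q : G × F₂hatT => Φ q.1 q.2 := by
  refine continuous_induced_rng.2 (continuous_pi fun H => ?_)
  haveI : DiscreteTopology ((diagram (GrpCat.of F₂)).obj H) := ⟨rfl⟩
  letI : TopologicalSpace (F₂ ⧸ H.toSubgroup) := ⊥
  haveI : DiscreteTopology (F₂ ⧸ H.toSubgroup) := ⟨rfl⟩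
  -- the `H`-component as a continuous homomorphism into the discrete finite quotient
  let πH : F₂hatT →ₜ* (F₂ ⧸ H.toSubgroup) :=
    { toFun := fun y => y.val H
      map_one' := rfl
      map_mul' := fun _ _ => rfl
      continuous_toFun := (continuous_apply H).comp continuous_subtype_val }
  -- the members of the family as continuous homomorphisms
  let Φc : G → (F₂hatT →ₜ* F₂hatT) := fun σ => { Φ σ with continuous_toFun := hc σ }
  refine (IsLocallyConstant.iff_exists_open _).2 (fun q₀ => ?_) |>.continuous
  refine ⟨(((fun σ => πH (Φ σ (eta (FreeGroup.of 0)))) ⁻¹' {πH (Φ q₀.1 (eta (FreeGroup.of 0)))}) ∩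
      ((fun σ => πH (Φ σ (eta (FreeGroup.of 1)))) ⁻¹' {πH (Φ q₀.1 (eta (FreeGroup.of 1)))})) ×ˢ
      ((fun x => πH (Φ q₀.1 x)) ⁻¹' {πH (Φ q₀.1 q₀.2)}), ?_, ⟨⟨rfl, rfl⟩, rfl⟩, ?_⟩
  · exact (((isOpen_discrete _).preimage (πH.continuous.comp h0)).inter
      ((isOpen_discrete _).preimage (πH.continuous.comp h1))).prod
      ((isOpen_discrete _).preimage (πH.continuous.comp (hc q₀.1)))
  · rintro ⟨σ, x⟩ ⟨⟨hσ0, hσ1⟩, hx⟩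
    have h0' : (πH.comp (Φc σ)) (eta (FreeGroup.of 0)) = (πH.comp (Φc q₀.1)) (eta (FreeGroup.of 0)) := hσ0
    have h1' : (πH.comp (Φc σ)) (eta (FreeGroup.of 1)) = (πH.comp (Φc q₀.1)) (eta (FreeGroup.of 1)) := hσ1
    have key : πH.comp (Φc σ) = πH.comp (Φc q₀.1) := ext_of_eta h0' h1'
    have hx' : πH (Φ q₀.1 x) = πH (Φ q₀.1 q₀.2) := hx
    have hσx : (πH.comp (Φc σ)) x = (πH.comp (Φc q₀.1)) x := DFunLike.congr_fun key x
    change πH (Φ σ x) = πH (Φ q₀.1 q₀.2)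
    exact hσx.trans hx'

/-- **Transport to `Γ = F̂₂ ×_Ẑ ℤ`.**  If a family `Φ : G → (Γ → Γ)` acts on coordinates by `Ψ σ × id` for a jointly
continuous `Ψ : G × F̂₂ → F̂₂`, then `(σ, γ) ↦ Φ σ γ` is jointly continuous (the topology of `Γ` is induced from
`F̂₂ × ℤ`). [cite: MochizukiEtTh2009, §1 p.12] -/
theorem continuous_actionGfp_of_continuous_action {G : Type*} [TopologicalSpace G]
    (Ψ : G → F₂hatT → F₂hatT) (Φ : G → Gfp → Gfp)
    (hΦ : ∀ σ γ, ((Φ σ γ : Gfp) : F₂hatT × Multiplicative ℤ) =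
      (Ψ σ (γ : F₂hatT × Multiplicative ℤ).1, (γ : F₂hatT × Multiplicative ℤ).2))
    (hΨ : Continuous fun q : G × F₂hatT => Ψ q.1 q.2) :
    Continuous fun q : G × Gfp => Φ q.1 q.2 := by
  refine continuous_induced_rng.2 ?_
  have hfun : (fun q : G × Gfp => ((Φ q.1 q.2 : Gfp) : F₂hatT × Multiplicative ℤ)) =
      fun q => (Ψ q.1 (q.2 : F₂hatT × Multiplicative ℤ).1, (q.2 : F₂hatT × Multiplicative ℤ).2) :=
    funext fun q => hΦ q.1 q.2
  change Continuous (fun q : G × Gfp => ((Φ q.1 q.2 : Gfp) : F₂hatT × Multiplicative ℤ))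
  rw [hfun]
  refine Continuous.prodMk ?_ (continuous_snd.comp (continuous_subtype_val.comp continuous_snd))
  have h2 : Continuous fun q : G × Gfp => (q.1, (q.2 : F₂hatT × Multiplicative ℤ).1) :=
    continuous_fst.prodMk (continuous_fst.comp (continuous_subtype_val.comp continuous_snd))
  exact Continuous.comp (f := fun q : G × Gfp => (q.1, (q.2 : F₂hatT × Multiplicative ℤ).1))
    (g := fun q : G × F₂hatT => Ψ q.1 q.2) hΨ h2

/-! ### The generator orbits of the three-parameter affine action `Inn(b^m) ∘ shear k ∘ θ_α` -/

/-- `affTwist₃ g (η a) = b^m · (η a · b^k) · b^{−m}` with `(m, k) = g.left`. [cite: MochizukiEtTh2009, Prop 1.5 (iii) p.23] -/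
theorem affTwist₃_eta_of_zero (g : (ZH × ZH) ⋊[diagAut] MulAut ZH) :
    affTwist₃ g (eta (FreeGroup.of 0)) = bPow g.left.1 * (eta (FreeGroup.of 0) * bPow g.left.2) * (bPow g.left.1)⁻¹ := by
  rw [affTwist₃_apply, twist_eta_of_zero, shear_eta_of_zero, innB_apply]

/-- `affTwist₃ g (η b) = b^{g.right (1)}`. [cite: MochizukiEtTh2009, Prop 1.5 (iii) p.23] -/
theorem affTwist₃_eta_of_one (g : (ZH × ZH) ⋊[diagAut] MulAut ZH) :
    affTwist₃ g (eta (FreeGroup.of 1)) = bPow (g.right (iotaZ (Multiplicative.ofAdd 1))) := by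
  rw [affTwist₃_apply, twist_eta_of_one, shear_bPow, innB_bPow]

/-- `affTwist₃Gfp` on coordinates: `(affTwist₃ g × id)|_Γ`. [cite: MochizukiEtTh2009, Prop 1.5 (iii) p.23] -/
theorem coe_affTwist₃Gfp (g : (ZH × ZH) ⋊[diagAut] MulAut ZH) (q : Gfp) :
    ((affTwist₃Gfp g q : Gfp) : F₂hatT × Multiplicative ℤ) =
      (affTwist₃ g (q : F₂hatT × Multiplicative ℤ).1, (q : F₂hatT × Multiplicative ℤ).2) := rfl

/-! ### Joint continuity of the affine action along continuous parameters -/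

/-- **The three-parameter affine action is jointly continuous along continuous parameters.**  For any
`ρ : G → (Ẑ × Ẑ) ⋊_{diag} Ẑ^×` with continuous coordinates `σ ↦ (ρ σ).left.1`, `σ ↦ (ρ σ).left.2` and
`σ ↦ (ρ σ).right (1)` (`G → Ẑ`), the map `(σ, x) ↦ affTwist₃ (ρ σ) x` on `G × F̂₂` is continuous — the generator
orbits `b^m · η a · b^k · b^{−m}` and `b^{α(1)}` are continuous, so `continuous_action_of_continuous_apply_eta`
applies. [cite: MochizukiEtTh2009, Prop 1.5 (iii) p.23] -/
theorem continuous_affTwist₃_of_continuous {G : Type*} [TopologicalSpace G] (ρ : G → (ZH × ZH) ⋊[diagAut] MulAut ZH)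
    (hm : Continuous fun σ => (ρ σ).left.1) (hk : Continuous fun σ => (ρ σ).left.2)
    (hα : Continuous fun σ => (ρ σ).right (iotaZ (Multiplicative.ofAdd 1))) :
    Continuous fun q : G × F₂hatT => affTwist₃ (ρ q.1) q.2 := by
  refine continuous_action_of_continuous_apply_eta (fun σ => (affTwist₃ (ρ σ)).toMonoidHom)
    (fun σ => continuous_affTwist₃ _) ?_ ?_
  · have hfun : (fun σ : G => (affTwist₃ (ρ σ)).toMonoidHom (eta (FreeGroup.of 0))) = fun σ =>
        bPow (ρ σ).left.1 * (eta (FreeGroup.of 0) * bPow (ρ σ).left.2) * (bPow (ρ σ).left.1)⁻¹ :=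
      funext fun σ => affTwist₃_eta_of_zero _
    rw [hfun]
    exact ((bPow.continuous.comp hm).mul (continuous_const.mul (bPow.continuous.comp hk))).mul
      (bPow.continuous.comp hm).inv
  · have hfun : (fun σ : G => (affTwist₃ (ρ σ)).toMonoidHom (eta (FreeGroup.of 1))) = fun σ =>
        bPow ((ρ σ).right (iotaZ (Multiplicative.ofAdd 1))) :=
      funext fun σ => affTwist₃_eta_of_one _
    rw [hfun]
    exact bPow.continuous.comp hα

/-- **The affine action on `Γ` is jointly continuous along continuous parameters** (same hypotheses; the input
making `Γ ⋊_{affTwist₃Gfp ∘ ρ} G` a topological group). [cite: MochizukiEtTh2009, Prop 1.5 (iii) p.23] -/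
theorem continuous_affTwist₃Gfp_of_continuous {G : Type*} [TopologicalSpace G]
    (ρ : G → (ZH × ZH) ⋊[diagAut] MulAut ZH)
    (hm : Continuous fun σ => (ρ σ).left.1) (hk : Continuous fun σ => (ρ σ).left.2)
    (hα : Continuous fun σ => (ρ σ).right (iotaZ (Multiplicative.ofAdd 1))) :
    Continuous fun q : G × Gfp => affTwist₃Gfp (ρ q.1) q.2 :=
  continuous_actionGfp_of_continuous_action (fun σ x => affTwist₃ (ρ σ) x) (fun σ γ => affTwist₃Gfp (ρ σ) γ)
    (fun σ γ => coe_affTwist₃Gfp (ρ σ) γ) (continuous_affTwist₃_of_continuous ρ hm hk hα)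

end Literature.AnabelianGeometry.EtaleTheta.SettingModel

end
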